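import Mathlib
import Summits.Ventures.HodgeRepro.CMHodge

/-!
# Zariski density of the `ℚ`-points of `K ⊗ ℂ = ℂ^{Hom(K, ℂ)}` (ROUTE.md R5, the density step)

ROUTE.md §4 item 1 (Route C, step R5 "dominance") ends with: "the ℚ-points
`Hom(A_{K′}, A) ⊗ ℚ ≅ ∏_j K_j^{n_j m_j}` are Zariski dense in `∏_{j,s} (W_{j,s})^{m_j}` because
`K_j ⊗ ℂ → ∏_{s ∈ Φ_j} ℂ` is surjective; 'wedge ≠ 0 at x' is Zariski-open and non-empty there; so
some ℚ-rational `f` has `df_x` surjective".  This file kernel-checks that sentence's linear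
algebra:

* `exists_rat_eval_ne_zero`: a non-zero polynomial in any number of variables over `ℂ` is
  non-zero at some `ℚ`-rational point (Mathlib's `MvPolynomial.funext_set` on the box `ℚ^σ`).
* `exists_rat_eval_ne_zero_of_surjective`: the same for the `ℚ`-form `L(ℚ^τ)` of a surjective
  linear map `L : ℂ^τ → ℂ^σ` — "a non-empty Zariski-open set of `ℂ^σ` meets the `ℚ`-points of
  any `ℚ`-form".
* `surjective_embCoord` + **`exists_eval_embeddings_ne_zero`**: for a number field `K`, the set
  `{(σ(a))_σ : a ∈ K} ⊂ ℂ^{Hom(K, ℂ)}` is Zariski dense — every non-zero polynomial function on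
  `ℂ^{Hom(K,ℂ)}` is non-zero at some `(σ(a))_σ` (the surjection is `ℂ ⊗_ℚ K ≅ ℂ^{Hom(K,ℂ)}`,
  `CMHodge.splitEquiv`, read in a `ℚ`-basis of `K`).

Applied to R5: the condition "`ω₁ ∧ g₂^*ω₂ ∧ ⋯ ∧ g_g^*ω_g ≠ 0` at `x`" is a polynomial in the
coefficients of the forms (a determinant), non-zero somewhere by Lemma W (Appendix A4, kernel-checked
in `BallGenLemmaW.lean`), hence non-zero at a `ℚ`-rational `f` (several corners = several copies of
the block `K_j ⊗ ℂ ≅ ℂ^{Hom}`; use `exists_rat_eval_ne_zero_of_surjective` with the block-diagonal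
surjection).  The geometric steps (compactness ⇒ dominance, Hecke-stability of the isotypic pieces)
are the route's printed/structural inputs and are not formalised.
-/

namespace HodgeRepro.Zariski

open MvPolynomial Module

/-- **Rational points are Zariski dense.** A non-zero polynomial over `ℂ` in variables `σ` is
non-zero at some point of `ℚ^σ`. -/
theorem exists_rat_eval_ne_zero {σ : Type*} (P : MvPolynomial σ ℂ) (hP : P ≠ 0) :
    ∃ q : σ → ℚ, eval (fun i => (q i : ℂ)) P ≠ 0 := by
  by_contra h
  push Not at h
  apply hP
  refine MvPolynomial.funext_set (fun _ : σ => Set.range ((↑) : ℚ → ℂ))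
    (fun _ => Set.infinite_range_of_injective Rat.cast_injective) fun x hx => ?_
  rw [map_zero]
  rw [Set.mem_univ_pi] at hx
  choose q hq using hx
  have hxq : x = fun i => (q i : ℂ) := funext fun i => (hq i).symm
  rw [hxq]
  exact h q

/-- **The `ℚ`-form of a surjective linear map has Zariski-dense `ℚ`-points.** If
`L x = (∑ j, A i j * x j)_i` is surjective `ℂ^τ → ℂ^σ`, every non-zero polynomial on `ℂ^σ` is
non-zero at some `L q`, `q ∈ ℚ^τ`. -/
theorem exists_rat_eval_ne_zero_of_surjective {σ τ : Type*} [Fintype τ] (A : σ → τ → ℂ)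
    (hA : Function.Surjective fun x : τ → ℂ => fun i => ∑ j, A i j * x j)
    (P : MvPolynomial σ ℂ) (hP : P ≠ 0) :
    ∃ q : τ → ℚ, eval (fun i => ∑ j, A i j * (q j : ℂ)) P ≠ 0 := by
  set P' : MvPolynomial τ ℂ := bind₁ (fun i => ∑ j, C (A i j) * X j) P with hP'
  have heval : ∀ x : τ → ℂ, eval x P' = eval (fun i => ∑ j, A i j * x j) P := by
    intro x
    have h1 : aeval x P' = aeval (fun i => aeval x (∑ j, C (A i j) * X j)) P := by
      rw [hP']
      exact aeval_bind₁ x _ P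
    have h2 : (fun i => aeval x (∑ j, C (A i j) * X j)) = fun i => ∑ j, A i j * x j := by
      funext i
      simp only [map_sum, map_mul, aeval_C, aeval_X, Algebra.algebraMap_self_apply]
    rw [h2] at h1
    exact h1
  have hP'ne : P' ≠ 0 := by
    intro h0
    apply hP
    refine MvPolynomial.funext fun y => ?_
    obtain ⟨x, rfl⟩ := hA y
    rw [map_zero, ← heval, h0, map_zero]
  obtain ⟨q, hq⟩ := exists_rat_eval_ne_zero P' hP'ne
  exact ⟨q, by rwa [heval] at hq⟩

variable (K : Type*) [Field K] [NumberField K]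

/-- The coordinate map `x ↦ (σ ↦ ∑ j, x j σ(b j))` (`b` a `ℚ`-basis of `K`) is surjective
`ℂ^{[K:ℚ]} → ℂ^{Hom(K,ℂ)}`: it is `ℂ ⊗_ℚ K ≅ ℂ^{Hom(K,ℂ)}` (`CMHodge.splitEquiv`) in the basis
`1 ⊗ b j`. -/
theorem surjective_embCoord :
    Function.Surjective fun x : Fin (finrank ℚ K) → ℂ =>
      fun σ : K →ₐ[ℚ] ℂ => ∑ j, σ (Module.finBasis ℚ K j) * x j := by
  intro v
  obtain ⟨t, ht⟩ := (CMHodge.splitEquiv K).surjective v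
  set b := Algebra.TensorProduct.basis ℂ (Module.finBasis ℚ K) with hb
  refine ⟨fun j => b.repr t j, ?_⟩
  funext σ
  rw [← ht]
  conv_rhs => rw [← b.sum_repr t]
  rw [map_sum, Finset.sum_apply]
  refine Finset.sum_congr rfl fun j _ => ?_
  rw [map_smul, Pi.smul_apply, smul_eq_mul, hb, Algebra.TensorProduct.basis_apply,
    CMHodge.splitEquiv_tmul, one_mul, mul_comm]

/-- **Zariski density of the `ℚ`-points of `ℂ^{Hom(K,ℂ)}` (R5's density step).** For a number
field `K`, every non-zero polynomial function on `ℂ^{Hom(K,ℂ)}` is non-zero at some point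
`(σ(a))_σ`, `a ∈ K`. -/
theorem exists_eval_embeddings_ne_zero (P : MvPolynomial (K →ₐ[ℚ] ℂ) ℂ) (hP : P ≠ 0) :
    ∃ a : K, eval (fun σ => σ a) P ≠ 0 := by
  obtain ⟨q, hq⟩ := exists_rat_eval_ne_zero_of_surjective
    (fun (σ : K →ₐ[ℚ] ℂ) j => σ (Module.finBasis ℚ K j)) (surjective_embCoord K) P hP
  refine ⟨∑ j, q j • Module.finBasis ℚ K j, ?_⟩
  convert hq using 3
  funext σ
  rw [map_sum]
  refine Finset.sum_congr rfl fun j _ => ?_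
  have hs : σ (q j • Module.finBasis ℚ K j) = q j • σ (Module.finBasis ℚ K j) :=
    σ.toLinearMap.map_smul (q j) (Module.finBasis ℚ K j)
  rw [hs, Rat.smul_def, mul_comm]

/-- Several copies at once (the shape `∏_{j,s} (W_{j,s})^{m_j}` of R5 for one field): the
block-diagonal coordinate map `ℂ^{m × [K:ℚ]} → ℂ^{m × Hom(K,ℂ)}` is surjective. -/
theorem surjective_embCoord_pi (m : ℕ) :
    Function.Surjective fun x : Fin m × Fin (finrank ℚ K) → ℂ =>
      fun q : Fin m × (K →ₐ[ℚ] ℂ) =>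
        ∑ p : Fin m × Fin (finrank ℚ K),
          (if q.1 = p.1 then q.2 (Module.finBasis ℚ K p.2) else 0) * x p := by
  intro v
  have h := fun k : Fin m => surjective_embCoord K (fun σ => v (k, σ))
  choose x hx using h
  refine ⟨fun p => x p.1 p.2, ?_⟩
  funext q
  have hq := congrFun (hx q.1) q.2
  simp only at hq
  show ∑ p : Fin m × Fin (finrank ℚ K),
      (if q.1 = p.1 then q.2 (Module.finBasis ℚ K p.2) else 0) * x p.1 p.2 = v q
  rw [Fintype.sum_prod_type, Finset.sum_comm]
  simp only [ite_mul, zero_mul, Finset.sum_ite_eq, Finset.mem_univ, if_true]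
  exact hq

/-- **Zariski density of the `ℚ`-points, several copies**: for `m` copies of `ℂ^{Hom(K,ℂ)}`, every
non-zero polynomial in the variables `Fin m × Hom(K,ℂ)` is non-zero at some point
`((σ(a_k))_σ)_k`, `a : Fin m → K`. -/
theorem exists_eval_embeddings_pi_ne_zero (m : ℕ)
    (P : MvPolynomial (Fin m × (K →ₐ[ℚ] ℂ)) ℂ) (hP : P ≠ 0) :
    ∃ a : Fin m → K, eval (fun q => q.2 (a q.1)) P ≠ 0 := by
  obtain ⟨q, hq⟩ := exists_rat_eval_ne_zero_of_surjective
    (fun (q : Fin m × (K →ₐ[ℚ] ℂ)) (p : Fin m × Fin (finrank ℚ K)) =>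
      if q.1 = p.1 then q.2 (Module.finBasis ℚ K p.2) else 0) (surjective_embCoord_pi K m) P hP
  refine ⟨fun k => ∑ j, q (k, j) • Module.finBasis ℚ K j, ?_⟩
  convert hq using 3
  funext r
  rw [map_sum r.2, Fintype.sum_prod_type, Finset.sum_comm]
  simp only [ite_mul, zero_mul, Finset.sum_ite_eq, Finset.mem_univ, if_true]
  refine Finset.sum_congr rfl fun j _ => ?_
  have hs : r.2 (q (r.1, j) • Module.finBasis ℚ K j) = q (r.1, j) • r.2 (Module.finBasis ℚ K j) :=
    r.2.toLinearMap.map_smul (q (r.1, j)) (Module.finBasis ℚ K j)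
  rw [hs, Rat.smul_def, mul_comm]

end HodgeRepro.Zariski
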